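import Literature.IUT.LogVolume.TameQuadraticCoordinates
import Literature.IUT.LogVolume.WildCubicIsometryMover
import HarnessLib

/-!
# Isometries FIX the maximal order of the tame quadratic packet: `K = ℚ_p(π)`, `π² = p`, `p` odd

Classical local algebra (nothing disputed; the [IUTchIV] locator records where the abc-iut cell uses it).
[IUTchIV] Prop. 1.1 p. 9 attaches to a tensor packet `V = ⊗_{ℚ_p} k_i` the lattice `R_I = ⊗_{ℤ_p} R_i` and its
normalisation `(R_I)^∼`, the MAXIMAL `ℤ_p`-order of `V` (campaign-S `normalizedPacket`; `ψ((R_I)^∼) = Π_j 𝒪_{L_j}` for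
the field-factor decomposition `ψ = dEquiv`).  `WildCubicIsometryMover` (`ℚ₃(∛3)`) and `WildQuadraticIsometryMover`
(`ℚ₂(√2)`) show that at a WILDLY ramified factor a `ℚ_p`-linear ISOMETRY of a factor may MOVE `(R_I)^∼`.  THIS FILE is
the positive statement at the smallest TAMELY RAMIFIED packet: `K` any ultrametric normed field over `ℚ_p`,
`[K : ℚ_p] = 2`, `π ∈ K`, `π² = p`, `p` an ODD prime, `V = K ⊗_{ℚ_p} K` (where `(R_I)^∼ ⊋ R_I = 𝒪 ⊗ 𝒪`).

* `exists_repr` — every `z ∈ K ⊗ K` is `1 ⊗ l₀ + π ⊗ l₁`; `dEquiv_iota_pi_eq_or`, `exists_factor_eq(_neg)` — in every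
  field factor `L_j` the two images of `π` agree UP TO SIGN and both signs occur, so `ψ(1 ⊗ l₀ + π ⊗ l₁)_j = ι_j(l₀ ± π·l₁)`;
* **`mem_normalizedPacket_iff_of_odd`** — `(R_I)^∼ = {1 ⊗ l₀ + π ⊗ l₁ : ‖l₀‖ ≤ 1, ‖π·l₁‖ ≤ 1}` for `p` odd (`⊇` for
  every `p`; `⊆` by `‖2‖ = 1`): the unit ball of the ultrametric tensor-product norm, which contains `p⁻¹·π ⊗ π ∉ R_I`;
* **`congr_mem_of_isometry`** — that set is mapped into itself by `σ ⊗ τ` for EVERY pair of `ℚ_p`-linear isometries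
  (only `‖σ 1‖ = 1`, `‖σ π‖ = ‖π‖` enter; any `p`);
* **`congr_mem_normalizedPacket_of_isometry`**, **`congr_image_normalizedPacket_eq_of_isometry`**,
  **`not_exists_isometry_mover`** — for `p` odd every factorwise isometry maps `(R_I)^∼` ONTO itself: NO pair
  (isometries `f`, `z ∈ (R_I)^∼`) with `(⊗ f_i)(z) ∉ (R_I)^∼` exists — the negation, at this packet, of the exhibit
  shape `hmove` of the abc-iut cell's Y-29b reduction `Joshi/TestRealPinsMaxOrderMover`;
* **`exists_tameQuadratic_isometry_stable`** — NON-VACUITY inside `ℚ̄_p` for every odd prime `p` (`E = ℚ_p(√p)`).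

Use (abc-iut cell, R-J row Y-29b «sign by place type»): the sign boundary for «`𝒪_v`-stable `ℚ_p`-linear ISOMETRIES
as the (Ind2)-binder» is WILD/TAME, not ramified/unramified.  CONTAINERS only; no side is taken on [IUTchIII]
Cor. 3.12.  Proof-only file (theorems, no definitions).
[cite: Mochizuki2012, IUTchIV Prop. 1.1 p. 9, Prop. 1.4 (i) p. 13] [cite: NeukirchANT1999, Ch. II (5.5)]
-/

noncomputable section

open Metric Set
open scoped TensorProduct

namespace Literature.IUT.LogVolume

namespace TameQuadratic

variable {p : ℕ} [Fact p.Prime]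
variable {K : Type} [NontriviallyNormedField K] [NormedAlgebra ℚ_[p] K] {π : K}

/-! ## Pure tensors of the two-factor packet `K ⊗_{ℚ_p} K` -/

/-- `x ⊗ y = ι₀(x)·ι₁(y)`. [cite: Mochizuki2012, IUTchIV Prop. 1.1 p. 9] -/
theorem purePacket_pair_eq_iota_mul (p : ℕ) [Fact p.Prime] [NormedAlgebra ℚ_[p] K] (x y : K) :
    purePacket p (fun _ : Fin 2 => K) ![x, y] =
      iota p (fun _ : Fin 2 => K) 0 x * iota p (fun _ : Fin 2 => K) 1 y := by
  rw [iota_eq_purePacket, iota_eq_purePacket, purePacket_mul]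
  congr 1; funext i; fin_cases i <;> simp

/-- Additivity in the left slot: `(x + x') ⊗ y = x ⊗ y + x' ⊗ y`. [cite: Mochizuki2012, IUTchIV Prop. 1.1 p. 9] -/
theorem purePacket_pair_add_left (p : ℕ) [Fact p.Prime] [NormedAlgebra ℚ_[p] K] (x x' y : K) :
    purePacket p (fun _ : Fin 2 => K) ![x + x', y] =
      purePacket p (fun _ : Fin 2 => K) ![x, y] + purePacket p (fun _ : Fin 2 => K) ![x', y] := by
  rw [purePacket_pair_eq_iota_mul, purePacket_pair_eq_iota_mul, purePacket_pair_eq_iota_mul, map_add, add_mul]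

/-- Additivity in the right slot: `x ⊗ (y + y') = x ⊗ y + x ⊗ y'`. [cite: Mochizuki2012, IUTchIV Prop. 1.1 p. 9] -/
theorem purePacket_pair_add_right (p : ℕ) [Fact p.Prime] [NormedAlgebra ℚ_[p] K] (x y y' : K) :
    purePacket p (fun _ : Fin 2 => K) ![x, y + y'] =
      purePacket p (fun _ : Fin 2 => K) ![x, y] + purePacket p (fun _ : Fin 2 => K) ![x, y'] := by
  rw [purePacket_pair_eq_iota_mul, purePacket_pair_eq_iota_mul, purePacket_pair_eq_iota_mul, map_add, mul_add]

/-- Scalars move between the slots: `(a·x) ⊗ y = x ⊗ (a·y)`. [cite: Mochizuki2012, IUTchIV Prop. 1.1 p. 9] -/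
theorem purePacket_pair_smul_left (a : ℚ_[p]) (x y : K) :
    purePacket p (fun _ : Fin 2 => K) ![a • x, y] = purePacket p (fun _ : Fin 2 => K) ![x, a • y] := by
  rw [purePacket_pair_eq_iota_mul, purePacket_pair_eq_iota_mul, map_smul, map_smul, smul_mul_assoc,
    mul_smul_comm]

/-- `(a·x) ⊗ y = a·(x ⊗ y)`. [cite: Mochizuki2012, IUTchIV Prop. 1.1 p. 9] -/
theorem purePacket_pair_smul_left' (a : ℚ_[p]) (x y : K) :
    purePacket p (fun _ : Fin 2 => K) ![a • x, y] = a • purePacket p (fun _ : Fin 2 => K) ![x, y] := by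
  rw [purePacket_pair_eq_iota_mul, purePacket_pair_eq_iota_mul, map_smul, smul_mul_assoc]

/-- `(⊗ f)(x ⊗ y) = f₀ x ⊗ f₁ y`. [cite: Mochizuki2012, IUTchIV Prop. 1.1 p. 9] -/
theorem congr_purePacket_pair (f : ∀ _ : Fin 2, K ≃ₗ[ℚ_[p]] K) (x y : K) :
    (PiTensorProduct.congr f :
        PacketAlgebra p (fun _ : Fin 2 => K) ≃ₗ[ℚ_[p]] PacketAlgebra p (fun _ : Fin 2 => K))
        (purePacket p (fun _ : Fin 2 => K) ![x, y]) =
      purePacket p (fun _ : Fin 2 => K) ![f 0 x, f 1 y] := by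
  rw [purePacket, purePacket, PiTensorProduct.congr_tprod]
  congr 1; funext i; fin_cases i <;> rfl

/-- `(⊗ f)((⊗ f⁻¹) z) = z`. [cite: Mochizuki2012, IUTchIV Prop. 1.1 p. 9] -/
theorem congr_congr_symm_apply (f : ∀ _ : Fin 2, K ≃ₗ[ℚ_[p]] K) (z : PacketAlgebra p (fun _ : Fin 2 => K)) :
    (PiTensorProduct.congr f :
        PacketAlgebra p (fun _ : Fin 2 => K) ≃ₗ[ℚ_[p]] PacketAlgebra p (fun _ : Fin 2 => K))
        ((PiTensorProduct.congr (fun i => (f i).symm) :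
          PacketAlgebra p (fun _ : Fin 2 => K) ≃ₗ[ℚ_[p]] PacketAlgebra p (fun _ : Fin 2 => K)) z) = z := by
  induction z using PiTensorProduct.induction_on with
  | smul_tprod r g =>
    rw [map_smul, map_smul, PiTensorProduct.congr_tprod, PiTensorProduct.congr_tprod]
    congr 2; funext i; exact (f i).apply_symm_apply (g i)
  | add x y hx hy => rw [map_add, map_add, hx, hy]

/-- **Every `z ∈ K ⊗_{ℚ_p} K` is `1 ⊗ l₀ + π ⊗ l₁`** (expand the left slot in the basis `(1, π)` and move the
coordinates to the right slot). [cite: Mochizuki2012, IUTchIV Prop. 1.1 p. 9] -/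
theorem exists_repr (B : Module.Basis (Fin 2) ℚ_[p] K) (hB0 : B 0 = 1) (hB1 : B 1 = π)
    (z : PacketAlgebra p (fun _ : Fin 2 => K)) :
    ∃ l₀ l₁ : K, z = purePacket p (fun _ : Fin 2 => K) ![1, l₀] + purePacket p (fun _ : Fin 2 => K) ![π, l₁] := by
  induction z using PiTensorProduct.induction_on with
  | smul_tprod r f =>
    have hf : PiTensorProduct.tprod ℚ_[p] f = purePacket p (fun _ : Fin 2 => K) ![f 0, f 1] := by
      rw [purePacket]; congr 1; funext i; fin_cases i <;> rfl
    have hf0 := (combo_repr B hB0 hB1 (f 0)).symm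
    refine ⟨r • (B.repr (f 0) 0 • f 1), r • (B.repr (f 0) 1 • f 1), ?_⟩
    rw [hf]
    conv_lhs =>
      rw [hf0, purePacket_pair_add_left, purePacket_pair_smul_left, purePacket_pair_smul_left, smul_add,
        ← purePacket_pair_smul_left' r, ← purePacket_pair_smul_left' r, purePacket_pair_smul_left,
        purePacket_pair_smul_left]
  | add x y hx hy =>
    obtain ⟨l₀, l₁, rfl⟩ := hx
    obtain ⟨m₀, m₁, rfl⟩ := hy
    exact ⟨l₀ + m₀, l₁ + m₁, by rw [purePacket_pair_add_right, purePacket_pair_add_right]; abel⟩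

/-- The functional `Φ = π^* ⊗ 1^*` (coordinate functionals of the basis `(1, π)`): `Φ(x ⊗ y) = x₁·y₀`.
[cite: Mochizuki2012, IUTchIV Prop. 1.1 p. 9] -/
theorem lift_coord_purePacket_pair (B : Module.Basis (Fin 2) ℚ_[p] K) (x y : K) :
    PiTensorProduct.lift ((MultilinearMap.mkPiAlgebra ℚ_[p] (Fin 2) ℚ_[p]).compLinearMap
        (![B.coord 1, B.coord 0] : ∀ _ : Fin 2, K →ₗ[ℚ_[p]] ℚ_[p]))
      (purePacket p (fun _ : Fin 2 => K) ![x, y]) = B.repr x 1 * B.repr y 0 := by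
  rw [purePacket, PiTensorProduct.lift.tprod, MultilinearMap.compLinearMap_apply, MultilinearMap.mkPiAlgebra_apply,
    Fin.prod_univ_two]
  rfl

/-- `π ⊗ 1 ≠ ε·(1 ⊗ π)` for every scalar `ε` (`Φ` takes the values `1` and `0`). [cite: Mochizuki2012, IUTchIV Prop. 1.1 p. 9] -/
theorem iota_pi_ne_smul (B : Module.Basis (Fin 2) ℚ_[p] K) (hB0 : B 0 = 1) (hB1 : B 1 = π) (ε : ℚ_[p]) :
    iota p (fun _ : Fin 2 => K) 0 π ≠ ε • iota p (fun _ : Fin 2 => K) 1 π := by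
  intro h
  obtain ⟨h10, h11, hπ0, hπ1⟩ := repr_one_pi B hB0 hB1
  have h0 : iota p (fun _ : Fin 2 => K) 0 π = purePacket p (fun _ : Fin 2 => K) ![π, 1] := by
    rw [iota_eq_purePacket]; congr 1; funext i; fin_cases i <;> simp
  have h1 : iota p (fun _ : Fin 2 => K) 1 π = purePacket p (fun _ : Fin 2 => K) ![1, π] := by
    rw [iota_eq_purePacket]; congr 1; funext i; fin_cases i <;> simp
  have hΦ := congrArg (PiTensorProduct.lift ((MultilinearMap.mkPiAlgebra ℚ_[p] (Fin 2) ℚ_[p]).compLinearMap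
        (![B.coord 1, B.coord 0] : ∀ _ : Fin 2, K →ₗ[ℚ_[p]] ℚ_[p]))) h
  rw [h0, h1, map_smul, lift_coord_purePacket_pair, lift_coord_purePacket_pair, hπ1, h10, h11, hπ0, mul_one,
    mul_zero, smul_zero] at hΦ
  exact one_ne_zero hΦ

/-! ## The field factors of `K ⊗_{ℚ_p} K` -/

section Factors

variable [ProperSpace K]

/-- `ψ(x ⊗ y)_j = ψ(ι₀ x)_j · ψ(ι₁ y)_j`. [cite: Mochizuki2012, IUTchIV Prop. 1.4 (i) p. 13] -/
theorem dEquiv_purePacket_pair (x y : K) (j : DIdx p (fun _ : Fin 2 => K)) :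
    dEquiv p (fun _ : Fin 2 => K) (purePacket p (fun _ : Fin 2 => K) ![x, y]) j =
      dEquiv p (fun _ : Fin 2 => K) (iota p (fun _ : Fin 2 => K) 0 x) j *
        dEquiv p (fun _ : Fin 2 => K) (iota p (fun _ : Fin 2 => K) 1 y) j := by
  rw [purePacket_pair_eq_iota_mul, map_mul, Pi.mul_apply]

/-- In every field factor `L_j`, the square of either image of `π` is `p`. [cite: Mochizuki2012, IUTchIV Prop. 1.4 (i) p. 13] -/
theorem dEquiv_iota_pi_sq (hπ : π ^ 2 = (p : K)) (i : Fin 2) (j : DIdx p (fun _ : Fin 2 => K)) :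
    dEquiv p (fun _ : Fin 2 => K) (iota p (fun _ : Fin 2 => K) i π) j ^ 2 = (p : DFac p (fun _ : Fin 2 => K) j) := by
  rw [← Pi.pow_apply, ← map_pow, ← map_pow, hπ, map_natCast, map_natCast, Pi.natCast_apply]

/-- **The two images of `π` in a field factor agree up to sign.** [cite: Mochizuki2012, IUTchIV Prop. 1.4 (i) p. 13] -/
theorem dEquiv_iota_pi_eq_or (hπ : π ^ 2 = (p : K)) (j : DIdx p (fun _ : Fin 2 => K)) :
    dEquiv p (fun _ : Fin 2 => K) (iota p (fun _ : Fin 2 => K) 0 π) j =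
        dEquiv p (fun _ : Fin 2 => K) (iota p (fun _ : Fin 2 => K) 1 π) j ∨
      dEquiv p (fun _ : Fin 2 => K) (iota p (fun _ : Fin 2 => K) 0 π) j =
        -dEquiv p (fun _ : Fin 2 => K) (iota p (fun _ : Fin 2 => K) 1 π) j :=
  sq_eq_sq_iff_eq_or_eq_neg.mp (by rw [dEquiv_iota_pi_sq hπ, dEquiv_iota_pi_sq hπ])

/-- **Some field factor sees the two images of `π` with the SAME sign** (else `π ⊗ 1 = −1 ⊗ π`) …
[cite: Mochizuki2012, IUTchIV Prop. 1.4 (i) p. 13] -/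
theorem exists_factor_eq [IsUltrametricDist K] (hK : Module.finrank ℚ_[p] K = 2) (hπ : π ^ 2 = (p : K)) :
    ∃ j : DIdx p (fun _ : Fin 2 => K),
      dEquiv p (fun _ : Fin 2 => K) (iota p (fun _ : Fin 2 => K) 0 π) j =
        dEquiv p (fun _ : Fin 2 => K) (iota p (fun _ : Fin 2 => K) 1 π) j := by
  obtain ⟨B, hB0, hB1⟩ := exists_basis hK hπ
  by_contra h
  apply iota_pi_ne_smul B hB0 hB1 (-1)
  apply (dEquiv p (fun _ : Fin 2 => K)).injective
  rw [map_smul, neg_one_smul]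
  funext j
  rw [Pi.neg_apply]
  exact (dEquiv_iota_pi_eq_or hπ j).resolve_left fun hj => h ⟨j, hj⟩

/-- … **and some field factor sees them with OPPOSITE signs** (else `π ⊗ 1 = 1 ⊗ π`).
[cite: Mochizuki2012, IUTchIV Prop. 1.4 (i) p. 13] -/
theorem exists_factor_eq_neg [IsUltrametricDist K] (hK : Module.finrank ℚ_[p] K = 2) (hπ : π ^ 2 = (p : K)) :
    ∃ j : DIdx p (fun _ : Fin 2 => K),
      dEquiv p (fun _ : Fin 2 => K) (iota p (fun _ : Fin 2 => K) 0 π) j =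
        -dEquiv p (fun _ : Fin 2 => K) (iota p (fun _ : Fin 2 => K) 1 π) j := by
  obtain ⟨B, hB0, hB1⟩ := exists_basis hK hπ
  by_contra h
  apply iota_pi_ne_smul B hB0 hB1 1
  apply (dEquiv p (fun _ : Fin 2 => K)).injective
  rw [one_smul]
  funext j
  exact (dEquiv_iota_pi_eq_or hπ j).resolve_right fun hj => h ⟨j, hj⟩

/-- **Field-factor coordinates of `1 ⊗ l₀ + π ⊗ l₁`**: `ψ(…)_j = ι_j(l₀ + π·l₁)` at a factor of the first kind …
[cite: Mochizuki2012, IUTchIV Prop. 1.4 (i) p. 13] -/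
theorem dEquiv_repr_of_eq {j : DIdx p (fun _ : Fin 2 => K)}
    (h : dEquiv p (fun _ : Fin 2 => K) (iota p (fun _ : Fin 2 => K) 0 π) j =
      dEquiv p (fun _ : Fin 2 => K) (iota p (fun _ : Fin 2 => K) 1 π) j) (l₀ l₁ : K) :
    dEquiv p (fun _ : Fin 2 => K)
        (purePacket p (fun _ : Fin 2 => K) ![1, l₀] + purePacket p (fun _ : Fin 2 => K) ![π, l₁]) j =
      dEquiv p (fun _ : Fin 2 => K) (iota p (fun _ : Fin 2 => K) 1 (l₀ + π * l₁)) j := by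
  rw [map_add, Pi.add_apply, dEquiv_purePacket_pair, dEquiv_purePacket_pair, h, map_one, map_one, Pi.one_apply,
    one_mul, map_add, map_add, Pi.add_apply, map_mul, map_mul, Pi.mul_apply]

/-- … and `ψ(…)_j = ι_j(l₀ − π·l₁)` at a factor of the second kind. [cite: Mochizuki2012, IUTchIV Prop. 1.4 (i) p. 13] -/
theorem dEquiv_repr_of_eq_neg {j : DIdx p (fun _ : Fin 2 => K)}
    (h : dEquiv p (fun _ : Fin 2 => K) (iota p (fun _ : Fin 2 => K) 0 π) j =
      -dEquiv p (fun _ : Fin 2 => K) (iota p (fun _ : Fin 2 => K) 1 π) j) (l₀ l₁ : K) :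
    dEquiv p (fun _ : Fin 2 => K)
        (purePacket p (fun _ : Fin 2 => K) ![1, l₀] + purePacket p (fun _ : Fin 2 => K) ![π, l₁]) j =
      dEquiv p (fun _ : Fin 2 => K) (iota p (fun _ : Fin 2 => K) 1 (l₀ - π * l₁)) j := by
  rw [map_add, Pi.add_apply, dEquiv_purePacket_pair, dEquiv_purePacket_pair, h, map_one, map_one, Pi.one_apply,
    one_mul, map_sub, map_sub, Pi.sub_apply, map_mul, map_mul, Pi.mul_apply, neg_mul, sub_eq_add_neg]

/-! ## The maximal order `(R_I)^∼` of `K ⊗_{ℚ_p} K` -/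

/-- A point all of whose field-factor coordinates have norm `≤ 1` lies in `(R_I)^∼` (`ψ((R_I)^∼) = Π_j 𝒪_{L_j}`).
[cite: Mochizuki2012, IUTchIV Prop. 1.4 (i) p. 13] -/
theorem mem_normalizedPacket_of_norm_dEquiv_le [IsUltrametricDist K] {x : PacketAlgebra p (fun _ : Fin 2 => K)}
    (h : ∀ j, ‖dEquiv p (fun _ : Fin 2 => K) x j‖ ≤ 1) : x ∈ normalizedPacket p (fun _ : Fin 2 => K) := by
  have hx : dEquiv p (fun _ : Fin 2 => K) x ∈
      (piUnitBallStructure (DFac p (fun _ : Fin 2 => K)) : Set (DSum p (fun _ : Fin 2 => K))) := by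
    rw [coe_piUnitBallStructure, mem_polydisc]
    exact h
  rw [← image_normalizedPacket_eq_coe] at hx
  obtain ⟨y, hy, hyx⟩ := hx
  rwa [← (dEquiv p (fun _ : Fin 2 => K)).injective hyx]

/-- **`1 ⊗ l₀ + π ⊗ l₁ ∈ (R_I)^∼` whenever `‖l₀‖ ≤ 1` and `‖π·l₁‖ ≤ 1`** (any prime `p`; e.g. `p⁻¹·π ⊗ π ∈ (R_I)^∼ ∖ R_I`):
every factor sees `ι_j(l₀ ± π·l₁)`, of norm `≤ max(‖l₀‖, ‖π·l₁‖)`. [cite: Mochizuki2012, IUTchIV Prop. 1.1 p. 9] -/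
theorem repr_mem_normalizedPacket [IsUltrametricDist K] (hπ : π ^ 2 = (p : K)) {l₀ l₁ : K} (h₀ : ‖l₀‖ ≤ 1) (h₁ : ‖π * l₁‖ ≤ 1) :
    purePacket p (fun _ : Fin 2 => K) ![1, l₀] + purePacket p (fun _ : Fin 2 => K) ![π, l₁] ∈
      normalizedPacket p (fun _ : Fin 2 => K) := by
  refine mem_normalizedPacket_of_norm_dEquiv_le fun j => ?_
  rcases dEquiv_iota_pi_eq_or hπ j with h | h
  · rw [dEquiv_repr_of_eq h, norm_dEquiv_iota]
    exact (IsUltrametricDist.norm_add_le_max _ _).trans (max_le h₀ h₁)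
  · rw [dEquiv_repr_of_eq_neg h, norm_dEquiv_iota, sub_eq_add_neg]
    exact (IsUltrametricDist.norm_add_le_max _ _).trans (max_le h₀ (by rwa [norm_neg]))

/-- **For `p` ODD, every `z ∈ (R_I)^∼` is `1 ⊗ l₀ + π ⊗ l₁` with `‖l₀‖ ≤ 1`, `‖π·l₁‖ ≤ 1`**: both `l₀ ± π·l₁` are
integral (one factor of each kind), and `‖2‖ = 1`. [cite: Mochizuki2012, IUTchIV Prop. 1.1 p. 9] -/
theorem exists_repr_of_mem_normalizedPacket [IsUltrametricDist K] (hp : p ≠ 2) (hK : Module.finrank ℚ_[p] K = 2) (hπ : π ^ 2 = (p : K))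
    {z : PacketAlgebra p (fun _ : Fin 2 => K)} (hz : z ∈ normalizedPacket p (fun _ : Fin 2 => K)) :
    ∃ l₀ l₁ : K, ‖l₀‖ ≤ 1 ∧ ‖π * l₁‖ ≤ 1 ∧
      z = purePacket p (fun _ : Fin 2 => K) ![1, l₀] + purePacket p (fun _ : Fin 2 => K) ![π, l₁] := by
  obtain ⟨B, hB0, hB1⟩ := exists_basis hK hπ
  obtain ⟨l₀, l₁, rfl⟩ := exists_repr B hB0 hB1 z
  obtain ⟨jp, hjp⟩ := exists_factor_eq (K := K) hK hπ
  obtain ⟨jm, hjm⟩ := exists_factor_eq_neg (K := K) hK hπ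
  have hplus : ‖l₀ + π * l₁‖ ≤ 1 := by
    have h := norm_dEquiv_le_one_of_mem_normalizedPacket p (fun _ : Fin 2 => K) hz jp
    rwa [dEquiv_repr_of_eq hjp, norm_dEquiv_iota] at h
  have hminus : ‖l₀ - π * l₁‖ ≤ 1 := by
    have h := norm_dEquiv_le_one_of_mem_normalizedPacket p (fun _ : Fin 2 => K) hz jm
    rwa [dEquiv_repr_of_eq_neg hjm, norm_dEquiv_iota] at h
  have h2 : ‖(2 : K)‖ = 1 := norm_two p hp
  have hminus' : ‖-(l₀ - π * l₁)‖ ≤ 1 := by rwa [norm_neg]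
  refine ⟨l₀, l₁, ?_, ?_, rfl⟩
  · have h : ‖(2 : K) * l₀‖ ≤ 1 := by
      rw [show (2 : K) * l₀ = (l₀ + π * l₁) + (l₀ - π * l₁) by ring]
      exact (IsUltrametricDist.norm_add_le_max _ _).trans (max_le hplus hminus)
    rwa [norm_mul, h2, one_mul] at h
  · have h : ‖(2 : K) * (π * l₁)‖ ≤ 1 := by
      rw [show (2 : K) * (π * l₁) = (l₀ + π * l₁) + -(l₀ - π * l₁) by ring]
      exact (IsUltrametricDist.norm_add_le_max _ _).trans (max_le hplus hminus')
    rwa [norm_mul, h2, one_mul] at h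

/-- **THE MAXIMAL ORDER OF THE TAME QUADRATIC PACKET** (`p` odd, `[K : ℚ_p] = 2`, `π² = p`):
`(R_I)^∼ = {1 ⊗ l₀ + π ⊗ l₁ : ‖l₀‖ ≤ 1, ‖π·l₁‖ ≤ 1}` — the unit ball of the ultrametric tensor-product norm, strictly
larger than `R_I = 𝒪_K ⊗ 𝒪_K`. [cite: Mochizuki2012, IUTchIV Prop. 1.1 p. 9] [cite: NeukirchANT1999, Ch. II (5.5)] -/
theorem mem_normalizedPacket_iff_of_odd [IsUltrametricDist K] (hp : p ≠ 2) (hK : Module.finrank ℚ_[p] K = 2) (hπ : π ^ 2 = (p : K))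
    (z : PacketAlgebra p (fun _ : Fin 2 => K)) :
    z ∈ normalizedPacket p (fun _ : Fin 2 => K) ↔
      ∃ l₀ l₁ : K, ‖l₀‖ ≤ 1 ∧ ‖π * l₁‖ ≤ 1 ∧
        z = purePacket p (fun _ : Fin 2 => K) ![1, l₀] + purePacket p (fun _ : Fin 2 => K) ![π, l₁] := by
  constructor
  · exact exists_repr_of_mem_normalizedPacket hp hK hπ
  · rintro ⟨l₀, l₁, h₀, h₁, rfl⟩
    exact repr_mem_normalizedPacket hπ h₀ h₁

end Factors

/-! ## Factorwise isometries -/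

/-- **`σ ⊗ τ` preserves `{1 ⊗ l₀ + π ⊗ l₁ : ‖l₀‖ ≤ 1, ‖π·l₁‖ ≤ 1}`** for every pair of `ℚ_p`-linear ISOMETRIES
`σ = f 0`, `τ = f 1` of `K` (any prime `p`): with `σ 1 = a₁ + b₁π`, `σ π = a₂ + b₂π` the image is
`1 ⊗ (a₁·τl₀ + a₂·τl₁) + π ⊗ (b₁·τl₀ + b₂·τl₁)`, and `‖a₁‖ ≤ 1`, `‖b₁‖‖π‖ ≤ 1`, `‖a₂‖ ≤ ‖π‖`, `‖b₂‖ ≤ 1`.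
[cite: NeukirchANT1999, Ch. II (5.5)] [cite: Mochizuki2012, IUTchIV Prop. 1.1 p. 9] -/
theorem congr_mem_of_isometry [IsUltrametricDist K] (hK : Module.finrank ℚ_[p] K = 2) (hπ : π ^ 2 = (p : K))
    (f : ∀ _ : Fin 2, K ≃ₗ[ℚ_[p]] K) (hf : ∀ i x, ‖f i x‖ = ‖x‖) {l₀ l₁ : K} (h₀ : ‖l₀‖ ≤ 1) (h₁ : ‖π * l₁‖ ≤ 1) :
    ∃ m₀ m₁ : K, ‖m₀‖ ≤ 1 ∧ ‖π * m₁‖ ≤ 1 ∧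
      (PiTensorProduct.congr f :
          PacketAlgebra p (fun _ : Fin 2 => K) ≃ₗ[ℚ_[p]] PacketAlgebra p (fun _ : Fin 2 => K))
          (purePacket p (fun _ : Fin 2 => K) ![1, l₀] + purePacket p (fun _ : Fin 2 => K) ![π, l₁]) =
        purePacket p (fun _ : Fin 2 => K) ![1, m₀] + purePacket p (fun _ : Fin 2 => K) ![π, m₁] := by
  obtain ⟨B, hB0, hB1⟩ := exists_basis hK hπ
  obtain ⟨ha₁, hb₁, ha₂, hb₂⟩ := isometry_coeff_bounds B hπ hB0 hB1 (f 0) (hf 0)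
  have hl₁ : ‖π‖ * ‖l₁‖ ≤ 1 := by rwa [← norm_mul]
  refine ⟨B.repr (f 0 1) 0 • f 1 l₀ + B.repr (f 0 π) 0 • f 1 l₁,
    B.repr (f 0 1) 1 • f 1 l₀ + B.repr (f 0 π) 1 • f 1 l₁, ?_, ?_, ?_⟩
  · refine (IsUltrametricDist.norm_add_le_max _ _).trans (max_le ?_ ?_)
    · rw [norm_smul, hf]
      exact mul_le_one₀ ha₁ (norm_nonneg _) h₀
    · rw [norm_smul, hf]
      exact (mul_le_mul_of_nonneg_right ha₂ (norm_nonneg _)).trans hl₁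
  · rw [norm_mul]
    refine (mul_le_mul_of_nonneg_left (IsUltrametricDist.norm_add_le_max _ _) (norm_nonneg _)).trans ?_
    rw [mul_max_of_nonneg _ _ (norm_nonneg π)]
    refine max_le ?_ ?_
    · rw [norm_smul, hf, ← mul_assoc, mul_comm ‖π‖]
      exact mul_le_one₀ hb₁ (norm_nonneg _) h₀
    · rw [norm_smul, hf, mul_left_comm]
      exact mul_le_one₀ hb₂ (mul_nonneg (norm_nonneg _) (norm_nonneg _)) hl₁
  · rw [map_add, congr_purePacket_pair, congr_purePacket_pair]
    conv_lhs => rw [← combo_repr B hB0 hB1 (f 0 1), ← combo_repr B hB0 hB1 (f 0 π)]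
    rw [purePacket_pair_add_left, purePacket_pair_add_left, purePacket_pair_smul_left, purePacket_pair_smul_left,
      purePacket_pair_smul_left, purePacket_pair_smul_left, purePacket_pair_add_right, purePacket_pair_add_right]
    abel

variable [IsUltrametricDist K] [ProperSpace K]

/-- **ISOMETRIES FIX THE MAXIMAL ORDER OF THE TAME QUADRATIC PACKET.**  `p` odd, `[K : ℚ_p] = 2`, `π² = p`: for
every pair of `ℚ_p`-linear isometries `f₀, f₁` of `K` and every `z ∈ (R_I)^∼`, `(f₀ ⊗ f₁)(z) ∈ (R_I)^∼`.
[cite: Mochizuki2012, IUTchIV Prop. 1.1 p. 9] [cite: NeukirchANT1999, Ch. II (5.5)] -/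
theorem congr_mem_normalizedPacket_of_isometry (hp : p ≠ 2) (hK : Module.finrank ℚ_[p] K = 2)
    (hπ : π ^ 2 = (p : K)) (f : ∀ _ : Fin 2, K ≃ₗ[ℚ_[p]] K) (hf : ∀ i x, ‖f i x‖ = ‖x‖)
    {z : PacketAlgebra p (fun _ : Fin 2 => K)} (hz : z ∈ normalizedPacket p (fun _ : Fin 2 => K)) :
    (PiTensorProduct.congr f :
        PacketAlgebra p (fun _ : Fin 2 => K) ≃ₗ[ℚ_[p]] PacketAlgebra p (fun _ : Fin 2 => K)) z ∈
      normalizedPacket p (fun _ : Fin 2 => K) := by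
  obtain ⟨l₀, l₁, h₀, h₁, rfl⟩ := exists_repr_of_mem_normalizedPacket hp hK hπ hz
  obtain ⟨m₀, m₁, hm₀, hm₁, hm⟩ := congr_mem_of_isometry hK hπ f hf h₀ h₁
  rw [hm]
  exact repr_mem_normalizedPacket hπ hm₀ hm₁

/-- **… and ONTO itself: `(f₀ ⊗ f₁)((R_I)^∼) = (R_I)^∼`** (apply the previous statement to `f` and to `f⁻¹`).
[cite: Mochizuki2012, IUTchIV Prop. 1.1 p. 9] [cite: NeukirchANT1999, Ch. II (5.5)] -/
theorem congr_image_normalizedPacket_eq_of_isometry (hp : p ≠ 2) (hK : Module.finrank ℚ_[p] K = 2)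
    (hπ : π ^ 2 = (p : K)) (f : ∀ _ : Fin 2, K ≃ₗ[ℚ_[p]] K) (hf : ∀ i x, ‖f i x‖ = ‖x‖) :
    (PiTensorProduct.congr f :
        PacketAlgebra p (fun _ : Fin 2 => K) ≃ₗ[ℚ_[p]] PacketAlgebra p (fun _ : Fin 2 => K)) ''
        (normalizedPacket p (fun _ : Fin 2 => K) : Set (PacketAlgebra p (fun _ : Fin 2 => K))) =
      (normalizedPacket p (fun _ : Fin 2 => K) : Set (PacketAlgebra p (fun _ : Fin 2 => K))) := by
  have hf' : ∀ i x, ‖(f i).symm x‖ = ‖x‖ := fun i x => by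
    conv_rhs => rw [← (f i).apply_symm_apply x]
    rw [hf]
  apply Set.Subset.antisymm
  · rintro _ ⟨z, hz, rfl⟩
    exact congr_mem_normalizedPacket_of_isometry hp hK hπ f hf hz
  · intro w hw
    exact ⟨_, congr_mem_normalizedPacket_of_isometry hp hK hπ (fun i => (f i).symm) hf' hw,
      congr_congr_symm_apply f w⟩

/-- **NO ISOMETRIC MAXIMAL-ORDER MOVER EXISTS AT THE TAME QUADRATIC PACKET** (`p` odd): there is no pair
(factorwise `ℚ_p`-linear isometries `f`, point `z ∈ (R_I)^∼`) with `(⊗ f_i)(z) ∉ (R_I)^∼` — contrast the wild movers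
of `WildCubicIsometryMover` / `WildQuadraticIsometryMover`. [cite: Mochizuki2012, IUTchIV Prop. 1.1 p. 9] -/
theorem not_exists_isometry_mover (hp : p ≠ 2) (hK : Module.finrank ℚ_[p] K = 2) (hπ : π ^ 2 = (p : K)) :
    ¬ ∃ (f : ∀ _ : Fin 2, K ≃ₗ[ℚ_[p]] K) (_ : ∀ i x, ‖f i x‖ = ‖x‖) (z : PacketAlgebra p (fun _ : Fin 2 => K)),
      z ∈ (normalizedPacket p (fun _ : Fin 2 => K) : Set (PacketAlgebra p (fun _ : Fin 2 => K))) ∧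
        (PiTensorProduct.congr f :
            PacketAlgebra p (fun _ : Fin 2 => K) ≃ₗ[ℚ_[p]] PacketAlgebra p (fun _ : Fin 2 => K)) z ∉
          (normalizedPacket p (fun _ : Fin 2 => K) : Set (PacketAlgebra p (fun _ : Fin 2 => K))) := by
  rintro ⟨f, hf, z, hz, hnot⟩
  exact hnot (congr_mem_normalizedPacket_of_isometry hp hK hπ f hf hz)

end TameQuadratic

/-! ## Non-vacuity: `ℚ_p(√p) ⊆ ℚ̄_p`, `p` odd -/

/-- **NON-VACUITY: AT `ℚ_p(√p)`, `p` ODD, FACTORWISE ISOMETRIES FIX THE MAXIMAL ORDER.**  For every odd prime `p`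
there is a finite `E ⊆ ℚ̄_p` with `[E : ℚ_p] = 2` (namely `E = ℚ_p(√p)`, totally and TAMELY ramified, `(R_I)^∼ ⊋ R_I`)
such that for ALL `ℚ_p`-linear isometries `f₀, f₁` of `E` (each maps `𝒪_E` and every `𝔪_E^n` onto itself) one has
`(f₀ ⊗ f₁)((R_I)^∼) = (R_I)^∼` in `E ⊗_{ℚ_p} E` — contrast `exists_wildCubic_isometry_maxOrder_mover`.
[cite: Mochizuki2012, IUTchIV Prop. 1.1 p. 9] [cite: NeukirchANT1999, Ch. II (5.5)] -/
theorem exists_tameQuadratic_isometry_stable (p : ℕ) [Fact p.Prime] (hp : p ≠ 2) :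
    ∃ (E : IntermediateField ℚ_[p] (PadicAlgCl p)) (_ : FiniteDimensional ℚ_[p] E),
      Module.finrank ℚ_[p] E = 2 ∧
        ∀ (f : ∀ _ : Fin 2, (E : Type) ≃ₗ[ℚ_[p]] E), (∀ i x, ‖f i x‖ = ‖x‖) →
          (∀ i (r : ℝ), f i '' closedBall (0 : E) r = closedBall 0 r) ∧
            (PiTensorProduct.congr f :
                PacketAlgebra p (fun _ : Fin 2 => (E : Type)) ≃ₗ[ℚ_[p]] PacketAlgebra p (fun _ : Fin 2 => (E : Type))) ''
                (normalizedPacket p (fun _ : Fin 2 => (E : Type)) :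
                  Set (PacketAlgebra p (fun _ : Fin 2 => (E : Type)))) =
              (normalizedPacket p (fun _ : Fin 2 => (E : Type)) : Set (PacketAlgebra p (fun _ : Fin 2 => (E : Type)))) := by
  obtain ⟨E, π, hfd, hK, hπ⟩ := TameQuadratic.exists_subfield p
  exact ⟨E, hfd, hK, fun f hf => ⟨fun i r => image_closedBall_eq_of_norm_map_eq p (f i) (hf i) r,
    TameQuadratic.congr_image_normalizedPacket_eq_of_isometry (K := E) hp hK hπ f hf⟩⟩

end Literature.IUT.LogVolume

end
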